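import Summits.QuantumFields.YangMills.Theorems.UnitScaleTiltProp7CommutatorChain
import Literature.MathematicalPhysics.QuantumFieldTheory.Balaban1983to89.B10Eq27TorusAxialLog
import Literature.MathematicalPhysics.QuantumFieldTheory.Balaban1983to89.B16Txt357ThirdOrderNonAbelian
import HarnessLib

/-!
# Route `UnitScaleTilt`, crux K1 «MinimiserStabilityRegPr» (stmt-QuantumFields-19200), route-R E′ path (α′), S3 K-form engine, row (R4′) — FILE 9e (ℤ^d word algebra):
# LADDERS ALONG A PATH AND THE COMB LOOP OF (27): `V(B ∪ μ ∪ −B ∪ −μ)` grows one conjugated plaquette per letter of `B` (so its commutator with a fixed `m` is the sum of the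
# plaquette commutators with the transported `m`, by ✓ `Prop7CommutatorChain`), and the loop `Γ_{0,x} ∪ ⟨x,μ⟩ ∪ −Γ_{0,x+e_μ}` IS a conjugated ladder along the part of the comb
# AFTER its `μ`-run

Cell `ym3-torus`, D-0154 (3c) twin-width seat `ym-routeR-w1` (gen 6); row (R4′) «framed-constant models in commutator currency» (namer ★ym-ust-19200-p1 g15; S3-CURVED verdict
2026-08-28 21:04Z «K-form engine GO door-first; R4 = ✓p666125 + (R4′)»; standing PASS reaffirmed 21:15Z; LOCATE v1.1 = 19200 evidence #52, §§2–4).  THEOREMS ONLY (0 `def`,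
0 `sorry`); `--supports stmt-QuantumFields-19200`, count-neutral.  YM₃ on T³ is a ladder rung (R3), not the Clay problem; nothing here claims a stub, the crux, d = 4 or the mass gap.

SETTING.  The `ℤ^d` cell letters of ✓ `B7Prop1Explicit` ∕ ✓ `B10Eq27AxialLog` (`hol V x w`, `disp`, `revWord`, `seg`, `treeWord`, `contour27`); a torus configuration is read through
its periodic pull-back (✓ `B10Eq27TorusAxialLog.hol_pull_zero`: `holT V c w = hol (pull V c) 0 w`, and `contourT c b := contour27 0 (rel c b.src) b.dir`), so every identity here
is an identity for the loops `holT V c (contourT c b)` of ✓ `Prop7AxialLocalModel` (F-H9e-core), with NO wrap-around hypothesis (words are relative).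
The LADDER of a word `B` with rung direction `μ` is the closed word `B ++ (μ,+) :: (revWord B ++ [(μ,−)])` (spelled out; no definition).

WHAT IS PROVED (ns `…Theorems.Prop7CombLadder`; `G` any group for §1 and §3, `𝔸ˣ` of a normed ring for §2 and §4).
* §1 `hol_backtrack` (`V(A l l̄ C) = V(A C)`), `hol_rung_nil` (`V(μ μ̄) = 1`), ★★ `hol_ladder_snoc` — THE RECURSION: `V(ladder_μ(B ++ [b])) = (V(B)·V_{x_B}(b μ b̄ μ̄)·V(B)⁻¹)·V(ladder_μ B)`
  (`V_{x_B}(b μ b̄ μ̄)` = the plaquette word spanned by `b` and `+e_μ` at the end `x_B = q + disp B` of `B`, in the orientation of `b`).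
* §2 `bicontr_hol`, `bicontr_conj` and ★★★ `comm_hol_ladder_le`: for bi-contractive `V` and every word `B`,
  `N_m(V(ladder_μ B)) ≤ Σ_{k<|B|} N_{R(V(B↾k)⁻¹)m}(V_{q+disp(B↾k)}(b_k μ b̄_k μ̄))` — one transported-plaquette commutator per letter (✓ `comm_mul_le`, ✓ `comm_conj_le`).
* §3 ★ `treeWord_split` (`Γ(v) = A ++ seg μ (v μ) ++ B`, `Γ(v + e_μ) = A ++ seg μ (v μ + 1) ++ B` with the SAME `A`, `B` = the runs of the directions listed before∕after `μ`),
  ★★ `hol_contour27_of_nonneg` ∕ `hol_contour27_of_neg` — THE COMB LOOP IS A CONJUGATED LADDER: for `v μ ≥ 0`,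
  `V(contour27 0 v μ) = T·V_q(ladder_μ B)·T⁻¹`, `T = V(A ++ seg μ (v μ))`, `q = disp(A ++ seg μ (v μ))`; for `v μ < 0` the same with `T = V(A ++ seg μ (v μ + 1))·V(q−e_μ,μ)⁻¹` and the
  ladder based at `q − e_μ` (the comb with its LAST `−e_μ` letter moved behind the rung).  For the LAST comb direction (`B = []`) the loop is trivial.
* §4 ★★★ `comm_hol_contour27_le` — the two combined: `N_m(V(Γ_{0,v} ∪ μ ∪ −Γ_{0,v+e_μ})) ≤ Σ_{k<|B|} N_{R((T·V_q(B↾k))⁻¹)m}(plaquette_k)`, `B` = the comb's tail after the `μ`-run: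
  the covariant derivative of the axial local model (✓ `Prop7AxialLocalModel.norm_covD_axialModel_le`) is booked by `|B| ≤ Σ_{κ after μ}|v κ|` transported-plaquette commutators.
* §5 `holT_contourT_eq_hol_pull` (the torus loop of ✓ `Prop7AxialLocalModel` IS the `ℤ^d` loop of the pull-back — so §§3–4 apply to it with `V ↦ pull V c`, NO wrap-around
  hypothesis), `bicontr_pull`.
HONEST SCOPE.  Word algebra and triangle inequalities only; no smallness of `V`.  The multiplicity counts over `(x, μ)` in a `4^d`-block neighbourhood, the comb AVERAGING over turning
offsets (LOCATE v1.1 (c3)), the junction to `φ₀(x_p)` (✓ `comm_le_comm_add`) and the instance in ✓p666125 are the next file (F-H9f).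

References: T. Bałaban, CMP 98 (1985) 17–51 [Balaban1985Averaging] ((8)–(9) pp.18–19, (19)–(20) p.21, p.24); CMP 102 (1985) 255–275 [Balaban1985UV3] ((27) p.263);
CMP 95 (1984) 17–40 [Balaban1984PropagatorsI] ((1.7) p.18).
-/

set_option autoImplicit false

noncomputable section

open scoped BigOperators

namespace Summit.QuantumFields.YangMills.Theorems.Prop7CombLadder

open Literature.MathematicalPhysics.QuantumFieldTheory.Balaban1983to89
open B7Prop1Explicit (Site Letter e disp revWord seg treeWord hol stepHol hol_cons hol_nil hol_append hol_revWord' stepHol_true stepHol_false stepHol_rev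
  disp_append disp_cons disp_nil disp_revWord revWord_append revWord_cons revWord_nil seg_natCast seg_neg_natCast)
open B10Eq27AxialLog (contour27)
open B9Eq39Adjoint (R)
open Summit.QuantumFields.YangMills.Theorems.Prop7CommutatorChain (comm_mul_le comm_conj_le comm_inv_le)
open B16Txt357ThirdOrderNonAbelian (norm_R_le)

/-! ## §1 Backtracks and the ladder recursion (any group) -/

section Group

variable {d : ℕ} {G : Type*} [Group G] (V : Site d → Fin d → G)

/-- **BACKTRACKS ARE FREE**: `V(A l l̄ C) = V(A C)`. [cite: Balaban1985Averaging, (9) p.18] -/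
theorem hol_backtrack (x : Site d) (A C : List (Letter d)) (l : Letter d) :
    hol V x (A ++ l :: l.rev :: C) = hol V x (A ++ C) := by
  rw [hol_append, hol_append, hol_cons, hol_cons, stepHol_rev, Letter.vec_rev, add_neg_cancel_right, ← mul_assoc (stepHol V _ l),
    mul_inv_cancel, one_mul]

/-- a closed word `W` sandwiched between `A` and `−A` transports by the conjugate: `V(A W (−A)) = V(A)·V_(x_A)(W)·V(A)⁻¹` (`disp W = 0`). [cite: Balaban1985Averaging, (9) p.18] -/
theorem hol_conj_append (x : Site d) (A W : List (Letter d)) (hW : disp W = 0) :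
    hol V x (A ++ (W ++ revWord A)) = hol V x A * hol V (x + disp A) W * (hol V x A)⁻¹ := by
  rw [hol_append, hol_append, hW, add_zero, hol_revWord' V (x + disp A) A rfl, mul_assoc]

/-- the empty ladder `μ μ̄` transports by `1`. [cite: Balaban1985Averaging, (9) p.18] -/
theorem hol_rung_nil (q : Site d) (μ : Fin d) : hol V q ((μ, true) :: ([] ++ [(μ, false)])) = 1 := by
  have h := hol_backtrack V q [] [] (μ, true)
  simpa using h

/-- `revWord (B ++ [b]) = b̄ :: revWord B`. [folklore] -/
theorem revWord_snoc (B : List (Letter d)) (b : Letter d) : revWord (B ++ [b]) = b.rev :: revWord B := by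
  rw [revWord_append, revWord_cons, revWord_nil, List.nil_append, List.singleton_append]

/-- the plaquette word `b μ b̄ μ̄` is closed. [folklore] -/
theorem disp_rung (b : Letter d) (μ : Fin d) : disp [b, (μ, true), b.rev, (μ, false)] = 0 := by
  simp only [disp_cons, disp_nil, Letter.vec_rev, Letter.vec_true, Letter.vec_false]
  abel

/-- ★★ **THE LADDER RECURSION**: `V(ladder_μ(B ++ [b])) = (V(B)·V_(x_B)(b μ b̄ μ̄)·V(B)⁻¹)·V(ladder_μ B)` — a ladder grows one conjugated plaquette word per letter.
[cite: Balaban1985Averaging, (9) pp.18-19, (19)-(20) p.21] -/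
theorem hol_ladder_snoc (q : Site d) (μ : Fin d) (B : List (Letter d)) (b : Letter d) :
    hol V q ((B ++ [b]) ++ (μ, true) :: (revWord (B ++ [b]) ++ [(μ, false)]))
      = (hol V q B * hol V (q + disp B) [b, (μ, true), b.rev, (μ, false)] * (hol V q B)⁻¹)
          * hol V q (B ++ (μ, true) :: (revWord B ++ [(μ, false)])) := by
  rw [revWord_snoc, hol_append V q B, List.append_assoc, hol_append V q B]
  -- both sides now start with `V(B)`; compare the transports from `x_B = q + disp B`
  rw [show [b] ++ (μ, true) :: (b.rev :: revWord B ++ [(μ, false)]) = [b, (μ, true), b.rev] ++ (revWord B ++ [(μ, false)]) by simp]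
  have hplaq : hol V (q + disp B) [b, (μ, true), b.rev, (μ, false)] * hol V (q + disp B) ((μ, true) :: (revWord B ++ [(μ, false)]))
      = hol V (q + disp B) ([b, (μ, true), b.rev] ++ (revWord B ++ [(μ, false)])) := by
    have h1 : hol V (q + disp B) ([b, (μ, true), b.rev, (μ, false)] ++ ((μ, true) :: (revWord B ++ [(μ, false)])))
        = hol V (q + disp B) [b, (μ, true), b.rev, (μ, false)] * hol V (q + disp B) ((μ, true) :: (revWord B ++ [(μ, false)])) := by
      rw [hol_append, disp_rung, add_zero]
    rw [← h1]
    have h2 : [b, (μ, true), b.rev, (μ, false)] ++ ((μ, true) :: (revWord B ++ [(μ, false)]))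
        = [b, (μ, true), b.rev] ++ ((μ, false) :: B7Prop1Explicit.Letter.rev ((μ, false) : Letter d) :: (revWord B ++ [(μ, false)])) := by simp
    rw [h2, hol_backtrack]
  rw [← hplaq]
  group

end Group

/-! ## §2 The ladder in commutator currency (units of a normed ring) -/

section Normed

variable {d : ℕ} {𝔸 : Type*} [NormedRing 𝔸] [NormOneClass 𝔸] (V : Site d → Fin d → 𝔸ˣ)
  (hV : ∀ (x : Site d) (κ : Fin d), ‖(V x κ : 𝔸)‖ ≤ 1 ∧ ‖(((V x κ)⁻¹ : 𝔸ˣ) : 𝔸)‖ ≤ 1)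

include hV

omit [NormOneClass 𝔸] in
/-- a single letter transports bi-contractively. [folklore] -/
theorem bicontr_stepHol (x : Site d) (l : Letter d) : ‖((stepHol V x l : 𝔸ˣ) : 𝔸)‖ ≤ 1 ∧ ‖(((stepHol V x l)⁻¹ : 𝔸ˣ) : 𝔸)‖ ≤ 1 := by
  obtain ⟨κ, s⟩ := l
  cases s
  · rw [stepHol_false, inv_inv]; exact ⟨(hV _ κ).2, (hV _ κ).1⟩
  · rw [stepHol_true]; exact hV x κ

/-- transports along words are bi-contractive. [folklore] -/
theorem bicontr_hol : ∀ (x : Site d) (w : List (Letter d)), ‖((hol V x w : 𝔸ˣ) : 𝔸)‖ ≤ 1 ∧ ‖(((hol V x w)⁻¹ : 𝔸ˣ) : 𝔸)‖ ≤ 1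
  | x, [] => by simp
  | x, l :: w => by
    obtain ⟨h1, h2⟩ := bicontr_hol (x + l.vec) w
    obtain ⟨s1, s2⟩ := bicontr_stepHol V hV x l
    refine ⟨?_, ?_⟩
    · rw [hol_cons, Units.val_mul]
      exact (norm_mul_le _ _).trans (by nlinarith [norm_nonneg ((stepHol V x l : 𝔸ˣ) : 𝔸), norm_nonneg ((hol V (x + l.vec) w : 𝔸ˣ) : 𝔸)])
    · rw [hol_cons, mul_inv_rev, Units.val_mul]
      exact (norm_mul_le _ _).trans (by nlinarith [norm_nonneg (((stepHol V x l)⁻¹ : 𝔸ˣ) : 𝔸), norm_nonneg (((hol V (x + l.vec) w)⁻¹ : 𝔸ˣ) : 𝔸)])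

omit hV [NormOneClass 𝔸] in
/-- a conjugated bi-contractive unit `T·P·T⁻¹` is bi-contractive. [folklore] -/
theorem bicontr_conj {T Q : 𝔸ˣ} (hT : ‖(T : 𝔸)‖ ≤ 1 ∧ ‖((T⁻¹ : 𝔸ˣ) : 𝔸)‖ ≤ 1) (hQ : ‖(Q : 𝔸)‖ ≤ 1 ∧ ‖((Q⁻¹ : 𝔸ˣ) : 𝔸)‖ ≤ 1) :
    ‖((T * Q * T⁻¹ : 𝔸ˣ) : 𝔸)‖ ≤ 1 ∧ ‖(((T * Q * T⁻¹)⁻¹ : 𝔸ˣ) : 𝔸)‖ ≤ 1 := by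
  refine ⟨?_, ?_⟩
  · rw [Units.val_mul, Units.val_mul]
    calc _ ≤ ‖(T : 𝔸)‖ * ‖(Q : 𝔸)‖ * ‖((T⁻¹ : 𝔸ˣ) : 𝔸)‖ := (norm_mul_le _ _).trans (mul_le_mul_of_nonneg_right (norm_mul_le _ _) (norm_nonneg _))
      _ ≤ 1 * 1 * 1 := mul_le_mul (mul_le_mul hT.1 hQ.1 (norm_nonneg _) zero_le_one) hT.2 (norm_nonneg _) (by positivity)
      _ = 1 := by ring
  · rw [mul_inv_rev, mul_inv_rev, inv_inv, Units.val_mul, Units.val_mul]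
    calc _ ≤ ‖(T : 𝔸)‖ * (‖((Q⁻¹ : 𝔸ˣ) : 𝔸)‖ * ‖((T⁻¹ : 𝔸ˣ) : 𝔸)‖) := (norm_mul_le _ _).trans (mul_le_mul_of_nonneg_left (norm_mul_le _ _) (norm_nonneg _))
      _ ≤ 1 * (1 * 1) := mul_le_mul hT.1 (mul_le_mul hQ.2 hT.2 (norm_nonneg _) zero_le_one) (by positivity) zero_le_one
      _ = 1 := by ring

/-- ★★★ **THE LADDER IN COMMUTATOR CURRENCY**: `N_m(V(ladder_μ B)) ≤ Σ_(k<|B|) N_(R(V(B↾k)⁻¹)m)(V_(q+disp(B↾k))(b_k μ b̄_k μ̄))` — the commutator of a fixed `m` with a ladder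
holonomy is at most the sum, over the letters of the path, of the commutators of the TRANSPORTED `m` with the plaquette words the ladder sweeps (`b_k` = the `k`-th letter, read
with a default that is never used). [cite: Balaban1985Averaging, (9) pp.18-19, (19)-(20) p.21] -/
theorem comm_hol_ladder_le (q : Site d) (μ : Fin d) (m : 𝔸) :
    ∀ B : List (Letter d),
      ‖((hol V q (B ++ (μ, true) :: (revWord B ++ [(μ, false)])) : 𝔸ˣ) : 𝔸) * m - m * ((hol V q (B ++ (μ, true) :: (revWord B ++ [(μ, false)])) : 𝔸ˣ) : 𝔸)‖
        ≤ ∑ k ∈ Finset.range B.length,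
            ‖((hol V (q + disp (B.take k)) [B.getD k (μ, true), (μ, true), (B.getD k (μ, true)).rev, (μ, false)] : 𝔸ˣ) : 𝔸) * R (hol V q (B.take k))⁻¹ m
              - R (hol V q (B.take k))⁻¹ m * ((hol V (q + disp (B.take k)) [B.getD k (μ, true), (μ, true), (B.getD k (μ, true)).rev, (μ, false)] : 𝔸ˣ) : 𝔸)‖ := by
  intro B
  induction B using List.reverseRecOn with
  | nil =>
    rw [List.nil_append, revWord_nil, hol_rung_nil]
    simp
  | append_singleton B b ih =>
    rw [hol_ladder_snoc, List.length_append, List.length_singleton, Finset.sum_range_succ]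
    -- the old rungs are unchanged
    have hsum : ∑ k ∈ Finset.range B.length,
        ‖((hol V (q + disp ((B ++ [b]).take k)) [(B ++ [b]).getD k (μ, true), (μ, true), ((B ++ [b]).getD k (μ, true)).rev, (μ, false)] : 𝔸ˣ) : 𝔸) * R (hol V q ((B ++ [b]).take k))⁻¹ m
          - R (hol V q ((B ++ [b]).take k))⁻¹ m * ((hol V (q + disp ((B ++ [b]).take k)) [(B ++ [b]).getD k (μ, true), (μ, true), ((B ++ [b]).getD k (μ, true)).rev, (μ, false)] : 𝔸ˣ) : 𝔸)‖
        = ∑ k ∈ Finset.range B.length,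
        ‖((hol V (q + disp (B.take k)) [B.getD k (μ, true), (μ, true), (B.getD k (μ, true)).rev, (μ, false)] : 𝔸ˣ) : 𝔸) * R (hol V q (B.take k))⁻¹ m
          - R (hol V q (B.take k))⁻¹ m * ((hol V (q + disp (B.take k)) [B.getD k (μ, true), (μ, true), (B.getD k (μ, true)).rev, (μ, false)] : 𝔸ˣ) : 𝔸)‖ := by
      refine Finset.sum_congr rfl fun k hk => ?_
      have hk' : k < B.length := Finset.mem_range.mp hk
      have htake : (B ++ [b]).take k = B.take k := List.take_append_of_le_length hk'.le
      have hget : (B ++ [b]).getD k (μ, true) = B.getD k (μ, true) := by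
        rw [List.getD_eq_getElem?_getD, List.getD_eq_getElem?_getD, List.getElem?_append_left hk']
      rw [htake, hget]
    -- the new rung
    have htakeN : (B ++ [b]).take B.length = B := by simp
    have hgetN : (B ++ [b]).getD B.length (μ, true) = b := by
      rw [List.getD_eq_getElem?_getD, List.getElem?_append_right le_rfl, Nat.sub_self]; simp
    rw [hsum, htakeN, hgetN]
    have hconj : ‖((hol V q B * hol V (q + disp B) [b, (μ, true), b.rev, (μ, false)] * (hol V q B)⁻¹ : 𝔸ˣ) : 𝔸)‖ ≤ 1
        ∧ ‖(((hol V q B * hol V (q + disp B) [b, (μ, true), b.rev, (μ, false)] * (hol V q B)⁻¹)⁻¹ : 𝔸ˣ) : 𝔸)‖ ≤ 1 :=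
      bicontr_conj (bicontr_hol V hV q B) (bicontr_hol V hV _ _)
    calc _ ≤ ‖((hol V q B * hol V (q + disp B) [b, (μ, true), b.rev, (μ, false)] * (hol V q B)⁻¹ : 𝔸ˣ) : 𝔸) * m
              - m * ((hol V q B * hol V (q + disp B) [b, (μ, true), b.rev, (μ, false)] * (hol V q B)⁻¹ : 𝔸ˣ) : 𝔸)‖
            + ‖((hol V q (B ++ (μ, true) :: (revWord B ++ [(μ, false)])) : 𝔸ˣ) : 𝔸) * m - m * ((hol V q (B ++ (μ, true) :: (revWord B ++ [(μ, false)])) : 𝔸ˣ) : 𝔸)‖ :=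
          comm_mul_le hconj (bicontr_hol V hV q _) m
      _ ≤ _ := by
          rw [add_comm]
          exact add_le_add ih (comm_conj_le (bicontr_hol V hV q B) _ m)

end Normed

/-! ## §3 The comb loop of (27) is a conjugated ladder (any group) -/

section Comb

variable {d : ℕ} {G : Type*} [Group G] (V : Site d → Fin d → G)

/-- the list of directions `d−1, …, 0` splits at `μ`, which occurs exactly once. [folklore] -/
theorem finRange_reverse_split (μ : Fin d) : ∃ s t : List (Fin d), (List.finRange d).reverse = s ++ μ :: t ∧ μ ∉ s ∧ μ ∉ t := by
  have hmem : μ ∈ (List.finRange d).reverse := List.mem_reverse.mpr (List.mem_finRange μ)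
  have hnd : (List.finRange d).reverse.Nodup := List.nodup_reverse.mpr (List.nodup_finRange d)
  obtain ⟨s, t, hst⟩ := List.append_of_mem hmem
  rw [hst] at hnd
  refine ⟨s, t, hst, ?_, ?_⟩
  · exact fun h => (List.nodup_append.mp hnd).2.2 μ h μ (List.mem_cons_self) rfl
  · exact fun h => ((List.nodup_cons.mp (List.nodup_append.mp hnd).2.1).1) h

/-- ★ **THE COMB SPLITS AT ITS `μ`-RUN**: `Γ(v) = A ++ seg μ (v μ) ++ B` with `A`, `B` the runs of the directions listed before∕after `μ`. [cite: Balaban1984PropagatorsI, (1.7) p.18] -/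
theorem treeWord_split (v : Site d) (μ : Fin d) {s t : List (Fin d)} (h : (List.finRange d).reverse = s ++ μ :: t) :
    treeWord v = s.flatMap (fun κ => seg κ (v κ)) ++ seg μ (v μ) ++ t.flatMap (fun κ => seg κ (v κ)) := by
  rw [treeWord, h, List.flatMap_append, List.flatMap_cons, List.append_assoc]

/-- the runs of the other directions do not see `v ↦ v + e_μ`. [folklore] -/
theorem flatMap_seg_add_e (v : Site d) (μ : Fin d) {l : List (Fin d)} (hl : μ ∉ l) :
    l.flatMap (fun κ => seg κ ((v + e μ) κ)) = l.flatMap (fun κ => seg κ (v κ)) := by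
  refine List.flatMap_congr fun κ hκ => ?_
  have hne : κ ≠ μ := fun hh => hl (hh ▸ hκ)
  rw [Pi.add_apply, B7Prop1Explicit.e_apply, if_neg hne, add_zero]

/-- `Γ(v + e_μ) = A ++ seg μ (v μ + 1) ++ B` with the SAME `A`, `B`. [cite: Balaban1984PropagatorsI, (1.7) p.18] -/
theorem treeWord_add_e_split (v : Site d) (μ : Fin d) {s t : List (Fin d)} (h : (List.finRange d).reverse = s ++ μ :: t) (hs : μ ∉ s) (ht : μ ∉ t) :
    treeWord (v + e μ) = s.flatMap (fun κ => seg κ (v κ)) ++ seg μ (v μ + 1) ++ t.flatMap (fun κ => seg κ (v κ)) := by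
  rw [treeWord_split (v + e μ) μ h, flatMap_seg_add_e v μ hs, flatMap_seg_add_e v μ ht, Pi.add_apply, B7Prop1Explicit.e_apply, if_pos rfl]

/-- `seg μ (n + 1) = seg μ n ++ [+e_μ]` for `n ≥ 0`. [folklore] -/
theorem seg_succ_of_nonneg (μ : Fin d) {n : ℤ} (hn : 0 ≤ n) : seg μ (n + 1) = seg μ n ++ [(μ, true)] := by
  obtain ⟨k, rfl⟩ := Int.eq_ofNat_of_zero_le hn
  rw [show ((k : ℤ) + 1) = ((k + 1 : ℕ) : ℤ) by push_cast; ring, seg_natCast, seg_natCast, List.replicate_succ']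

/-- `seg μ n = seg μ (n + 1) ++ [−e_μ]` for `n < 0`. [folklore] -/
theorem seg_of_neg (μ : Fin d) {n : ℤ} (hn : n < 0) : seg μ n = seg μ (n + 1) ++ [(μ, false)] := by
  obtain ⟨k, hk⟩ := Int.exists_eq_neg_ofNat hn.le
  have hk0 : k ≠ 0 := by rintro rfl; simp [hk] at hn
  obtain ⟨j, rfl⟩ := Nat.exists_eq_succ_of_ne_zero hk0
  rw [hk, show (-((j.succ : ℕ) : ℤ) + 1) = -((j : ℕ) : ℤ) by push_cast; ring, seg_neg_natCast, seg_neg_natCast, Nat.succ_eq_add_one,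
    List.replicate_succ']

/-- the word of (27) from `0`, normalised: `Γ(v) ++ [+e_μ] ++ (Γ(v + e_μ))⁻¹`. [cite: Balaban1985UV3, (27) p.263] -/
theorem contour27_zero (v : Site d) (μ : Fin d) : contour27 0 v μ = treeWord v ++ [(μ, true)] ++ revWord (treeWord (v + e μ)) := by
  rw [contour27, sub_zero, sub_zero]

/-- the ladder word is closed. [folklore] -/
theorem disp_ladder (μ : Fin d) (B : List (Letter d)) : disp (B ++ (μ, true) :: (revWord B ++ [(μ, false)])) = 0 := by
  simp only [disp_append, disp_cons, disp_nil, disp_revWord, Letter.vec_true, Letter.vec_false, add_zero]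
  abel

/-- ★★ **THE COMB LOOP IS A CONJUGATED LADDER, `v μ ≥ 0`**: `V(Γ_{0,v} ∪ μ ∪ −Γ_{0,v+e_μ}) = T·V_q(ladder_μ B)·T⁻¹` with `T = V(A ++ seg μ (v μ))`, `q` its end, and `B` the comb's runs
AFTER the `μ`-run. [cite: Balaban1985UV3, (27) p.263; Balaban1985Averaging, (9) p.19] -/
theorem hol_contour27_of_nonneg (v : Site d) (μ : Fin d) {s t : List (Fin d)} (h : (List.finRange d).reverse = s ++ μ :: t) (hs : μ ∉ s) (ht : μ ∉ t)
    (hv : 0 ≤ v μ) :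
    hol V 0 (contour27 0 v μ)
      = hol V 0 (s.flatMap (fun κ => seg κ (v κ)) ++ seg μ (v μ))
        * hol V (disp (s.flatMap (fun κ => seg κ (v κ)) ++ seg μ (v μ)))
            (t.flatMap (fun κ => seg κ (v κ)) ++ (μ, true) :: (revWord (t.flatMap (fun κ => seg κ (v κ))) ++ [(μ, false)]))
        * (hol V 0 (s.flatMap (fun κ => seg κ (v κ)) ++ seg μ (v μ)))⁻¹ := by
  set A := s.flatMap (fun κ => seg κ (v κ)) with hA
  set B := t.flatMap (fun κ => seg κ (v κ)) with hB
  set S := seg μ (v μ) with hS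
  have hw : contour27 0 v μ = (A ++ S) ++ ((B ++ (μ, true) :: (revWord B ++ [(μ, false)])) ++ revWord (A ++ S)) := by
    rw [contour27_zero, treeWord_split v μ h, treeWord_add_e_split v μ h hs ht, seg_succ_of_nonneg μ hv, ← hA, ← hB, ← hS]
    simp only [revWord_append, revWord_cons, List.append_assoc, List.cons_append, List.nil_append, B7Prop1Explicit.Letter.rev_mk, Bool.not_true]
  rw [hw, hol_conj_append V 0 (A ++ S) _ (disp_ladder μ B), zero_add]

/-- ★★ **THE COMB LOOP IS A CONJUGATED LADDER, `v μ < 0`**: the same with `T = V(A ++ seg μ (v μ + 1))·V(q − e_μ, μ)⁻¹` and the ladder based at `q − e_μ` (the comb's last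
`−e_μ` letter moved behind the rung). [cite: Balaban1985UV3, (27) p.263; Balaban1985Averaging, (9) p.19] -/
theorem hol_contour27_of_neg (v : Site d) (μ : Fin d) {s t : List (Fin d)} (h : (List.finRange d).reverse = s ++ μ :: t) (hs : μ ∉ s) (ht : μ ∉ t)
    (hv : v μ < 0) :
    hol V 0 (contour27 0 v μ)
      = (hol V 0 (s.flatMap (fun κ => seg κ (v κ)) ++ seg μ (v μ + 1))
            * stepHol V (disp (s.flatMap (fun κ => seg κ (v κ)) ++ seg μ (v μ + 1))) (μ, false))
        * hol V (disp (s.flatMap (fun κ => seg κ (v κ)) ++ seg μ (v μ + 1)) - e μ)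
            (t.flatMap (fun κ => seg κ (v κ)) ++ (μ, true) :: (revWord (t.flatMap (fun κ => seg κ (v κ))) ++ [(μ, false)]))
        * (hol V 0 (s.flatMap (fun κ => seg κ (v κ)) ++ seg μ (v μ + 1))
            * stepHol V (disp (s.flatMap (fun κ => seg κ (v κ)) ++ seg μ (v μ + 1))) (μ, false))⁻¹ := by
  set A := s.flatMap (fun κ => seg κ (v κ)) with hA
  set B := t.flatMap (fun κ => seg κ (v κ)) with hB
  set S' := seg μ (v μ + 1) with hS'
  have hw : contour27 0 v μ = (A ++ S') ++ (((μ, false) :: (B ++ (μ, true) :: revWord B)) ++ revWord (A ++ S')) := by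
    rw [contour27_zero, treeWord_split v μ h, treeWord_add_e_split v μ h hs ht, seg_of_neg μ hv, ← hA, ← hB, ← hS']
    simp only [revWord_append, List.append_assoc, List.cons_append, List.nil_append]
  have hmid : disp ((μ, false) :: (B ++ (μ, true) :: revWord B)) = 0 := by
    simp only [disp_append, disp_cons, disp_revWord, Letter.vec_true, Letter.vec_false]; abel
  rw [hw, hol_conj_append V 0 (A ++ S') _ hmid, zero_add]
  -- the middle word: move the leading `−e_μ` behind the rung by conjugation
  set q := disp (A ++ S') with hq
  have hW : disp (B ++ (μ, true) :: revWord B) = e μ := by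
    simp only [disp_append, disp_cons, disp_revWord, Letter.vec_true]; abel
  have hlad : hol V (q - e μ) (B ++ (μ, true) :: (revWord B ++ [(μ, false)])) = hol V (q - e μ) (B ++ (μ, true) :: revWord B) * stepHol V q (μ, false) := by
    rw [show B ++ (μ, true) :: (revWord B ++ [(μ, false)]) = (B ++ (μ, true) :: revWord B) ++ [(μ, false)] by simp, hol_append, hW, sub_add_cancel,
      show hol V q [(μ, false)] = stepHol V q (μ, false) by rw [hol_cons, hol_nil, mul_one]]
  rw [hol_cons, Letter.vec_false, ← sub_eq_add_neg, hlad]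
  group

end Comb

/-! ## §4 The comb loop in commutator currency -/

section CombNormed

variable {d : ℕ} {𝔸 : Type*} [NormedRing 𝔸] [NormOneClass 𝔸] (V : Site d → Fin d → 𝔸ˣ)
  (hV : ∀ (x : Site d) (κ : Fin d), ‖(V x κ : 𝔸)‖ ≤ 1 ∧ ‖(((V x κ)⁻¹ : 𝔸ˣ) : 𝔸)‖ ≤ 1)

include hV

/-- ★★★ **THE COMB LOOP IN COMMUTATOR CURRENCY** (`v μ ≥ 0`): `N_m(V(Γ_{0,v} ∪ μ ∪ −Γ_{0,v+e_μ})) ≤ Σ_(k<|B|) N_(m_k)(plaquette_k)` with `B` the comb's tail after the `μ`-run,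
`plaquette_k` the plaquette word spanned by `b_k` and `+e_μ` at the `k`-th point of the tail, and `m_k = R((V(B↾k))⁻¹)(R(T⁻¹)m)` the element transported there.
[cite: Balaban1985UV3, (27) p.263; Balaban1985Averaging, (9) pp.18-19, (19)-(20) p.21] -/
theorem comm_hol_contour27_le_of_nonneg (v : Site d) (μ : Fin d) {s t : List (Fin d)} (h : (List.finRange d).reverse = s ++ μ :: t) (hs : μ ∉ s) (ht : μ ∉ t)
    (hv : 0 ≤ v μ) (m : 𝔸) :
    ‖((hol V 0 (contour27 0 v μ) : 𝔸ˣ) : 𝔸) * m - m * ((hol V 0 (contour27 0 v μ) : 𝔸ˣ) : 𝔸)‖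
      ≤ ∑ k ∈ Finset.range (t.flatMap (fun κ => seg κ (v κ))).length,
          ‖((hol V (disp (s.flatMap (fun κ => seg κ (v κ)) ++ seg μ (v μ)) + disp ((t.flatMap (fun κ => seg κ (v κ))).take k))
                [(t.flatMap (fun κ => seg κ (v κ))).getD k (μ, true), (μ, true), ((t.flatMap (fun κ => seg κ (v κ))).getD k (μ, true)).rev, (μ, false)] : 𝔸ˣ) : 𝔸)
              * R (hol V (disp (s.flatMap (fun κ => seg κ (v κ)) ++ seg μ (v μ))) ((t.flatMap (fun κ => seg κ (v κ))).take k))⁻¹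
                  (R (hol V 0 (s.flatMap (fun κ => seg κ (v κ)) ++ seg μ (v μ)))⁻¹ m)
            - R (hol V (disp (s.flatMap (fun κ => seg κ (v κ)) ++ seg μ (v μ))) ((t.flatMap (fun κ => seg κ (v κ))).take k))⁻¹
                  (R (hol V 0 (s.flatMap (fun κ => seg κ (v κ)) ++ seg μ (v μ)))⁻¹ m)
              * ((hol V (disp (s.flatMap (fun κ => seg κ (v κ)) ++ seg μ (v μ)) + disp ((t.flatMap (fun κ => seg κ (v κ))).take k))
                [(t.flatMap (fun κ => seg κ (v κ))).getD k (μ, true), (μ, true), ((t.flatMap (fun κ => seg κ (v κ))).getD k (μ, true)).rev, (μ, false)] : 𝔸ˣ) : 𝔸)‖ := by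
  rw [hol_contour27_of_nonneg V v μ h hs ht hv]
  exact (comm_conj_le (bicontr_hol V hV 0 _) _ m).trans (comm_hol_ladder_le V hV _ μ _ _)

/-- ★★★ **THE COMB LOOP IN COMMUTATOR CURRENCY** (`v μ < 0`): the same, the transport `T` carrying the extra letter `V(q − e_μ, μ)⁻¹` and the ladder based at `q − e_μ`.
[cite: Balaban1985UV3, (27) p.263; Balaban1985Averaging, (9) pp.18-19, (19)-(20) p.21] -/
theorem comm_hol_contour27_le_of_neg (v : Site d) (μ : Fin d) {s t : List (Fin d)} (h : (List.finRange d).reverse = s ++ μ :: t) (hs : μ ∉ s) (ht : μ ∉ t)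
    (hv : v μ < 0) (m : 𝔸) :
    ‖((hol V 0 (contour27 0 v μ) : 𝔸ˣ) : 𝔸) * m - m * ((hol V 0 (contour27 0 v μ) : 𝔸ˣ) : 𝔸)‖
      ≤ ∑ k ∈ Finset.range (t.flatMap (fun κ => seg κ (v κ))).length,
          ‖((hol V (disp (s.flatMap (fun κ => seg κ (v κ)) ++ seg μ (v μ + 1)) - e μ + disp ((t.flatMap (fun κ => seg κ (v κ))).take k))
                [(t.flatMap (fun κ => seg κ (v κ))).getD k (μ, true), (μ, true), ((t.flatMap (fun κ => seg κ (v κ))).getD k (μ, true)).rev, (μ, false)] : 𝔸ˣ) : 𝔸)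
              * R (hol V (disp (s.flatMap (fun κ => seg κ (v κ)) ++ seg μ (v μ + 1)) - e μ) ((t.flatMap (fun κ => seg κ (v κ))).take k))⁻¹
                  (R (hol V 0 (s.flatMap (fun κ => seg κ (v κ)) ++ seg μ (v μ + 1))
                        * stepHol V (disp (s.flatMap (fun κ => seg κ (v κ)) ++ seg μ (v μ + 1))) (μ, false))⁻¹ m)
            - R (hol V (disp (s.flatMap (fun κ => seg κ (v κ)) ++ seg μ (v μ + 1)) - e μ) ((t.flatMap (fun κ => seg κ (v κ))).take k))⁻¹
                  (R (hol V 0 (s.flatMap (fun κ => seg κ (v κ)) ++ seg μ (v μ + 1))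
                        * stepHol V (disp (s.flatMap (fun κ => seg κ (v κ)) ++ seg μ (v μ + 1))) (μ, false))⁻¹ m)
              * ((hol V (disp (s.flatMap (fun κ => seg κ (v κ)) ++ seg μ (v μ + 1)) - e μ + disp ((t.flatMap (fun κ => seg κ (v κ))).take k))
                [(t.flatMap (fun κ => seg κ (v κ))).getD k (μ, true), (μ, true), ((t.flatMap (fun κ => seg κ (v κ))).getD k (μ, true)).rev, (μ, false)] : 𝔸ˣ) : 𝔸)‖ := by
  rw [hol_contour27_of_neg V v μ h hs ht hv]
  have hT : ‖((hol V 0 (s.flatMap (fun κ => seg κ (v κ)) ++ seg μ (v μ + 1))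
        * stepHol V (disp (s.flatMap (fun κ => seg κ (v κ)) ++ seg μ (v μ + 1))) (μ, false) : 𝔸ˣ) : 𝔸)‖ ≤ 1
      ∧ ‖(((hol V 0 (s.flatMap (fun κ => seg κ (v κ)) ++ seg μ (v μ + 1))
        * stepHol V (disp (s.flatMap (fun κ => seg κ (v κ)) ++ seg μ (v μ + 1))) (μ, false))⁻¹ : 𝔸ˣ) : 𝔸)‖ ≤ 1 := by
    have h2 := bicontr_hol V hV 0 ((s.flatMap (fun κ => seg κ (v κ)) ++ seg μ (v μ + 1)) ++ [(μ, false)])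
    rwa [hol_append, zero_add, show hol V (disp (s.flatMap (fun κ => seg κ (v κ)) ++ seg μ (v μ + 1))) [(μ, false)]
      = stepHol V (disp (s.flatMap (fun κ => seg κ (v κ)) ++ seg μ (v μ + 1))) (μ, false) by rw [hol_cons, hol_nil, mul_one]] at h2
  exact (comm_conj_le hT _ m).trans (comm_hol_ladder_le V hV _ μ _ _)

end CombNormed

/-! ## §5 Dictionary to the torus loops of (27) -/

section Torus

variable {P : Params} {j : ℕ} {G : Type*} [Group G]

/-- the torus loop of (27) IS the `ℤ^d` loop of the periodic pull-back: `V(contourT c b) = (pull V c)(contour27 0 (rel c b₋) dir b)`.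
[cite: Balaban1985UV3, (27) p.263; Balaban1985Averaging, (9) p.18] -/
theorem holT_contourT_eq_hol_pull (V : GaugeField P j G) (c : _root_.Literature.MathematicalPhysics.QuantumFieldTheory.Balaban1983to89.Site P j) (b : PBond P j) :
    B10Eq27TorusAxialLog.holT V c (B10Eq27TorusAxialLog.contourT c b)
      = hol (B10Eq27TorusAxialLog.pull V c) 0 (contour27 0 (B10Eq27TorusAxialLog.rel c b.src) b.dir) := by
  rw [B10Eq27TorusAxialLog.contourT, B10Eq27TorusAxialLog.hol_pull_zero]

/-- the pull-back of a bi-contractive torus configuration is bi-contractive. [folklore] -/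
theorem bicontr_pull {𝔸 : Type*} [NormedRing 𝔸] (V : GaugeField P j 𝔸ˣ) (hV : ∀ b : PBond P j, ‖(V b : 𝔸)‖ ≤ 1 ∧ ‖(((V b)⁻¹ : 𝔸ˣ) : 𝔸)‖ ≤ 1)
    (c : _root_.Literature.MathematicalPhysics.QuantumFieldTheory.Balaban1983to89.Site P j) (z : Site P.d) (κ : Fin P.d) :
    ‖((B10Eq27TorusAxialLog.pull V c z κ : 𝔸ˣ) : 𝔸)‖ ≤ 1 ∧ ‖(((B10Eq27TorusAxialLog.pull V c z κ)⁻¹ : 𝔸ˣ) : 𝔸)‖ ≤ 1 := by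
  rw [B10Eq27TorusAxialLog.pull_apply]; exact hV _

end Torus

end Summit.QuantumFields.YangMills.Theorems.Prop7CombLadder

end
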